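import Mathlib.Analysis.SpecialFunctions.Pow.Real
import HarnessLib

/-!
# An irrationality measure from a sequence of good rational approximations (Thue–Siegel–Baker lemma)

The standard closing lemma of the hypergeometric (Thue–Siegel) method, in the form printed as
Lemma 8 of §2 of Chen–Voutier [ChenVoutier1997] (arXiv:1401.5450 numbering; "very much like Lemma 3
of [Chen1]", going back to Baker 1964 and Siegel 1937): if a real number `θ` admits, for every `r ∈ ℕ`,
integers `p_r, q_r` with `|q_r| < k₀ Qʳ`, `|q_r θ − p_r| ≤ l₀ E^{−r}` and `p_r q_{r+1} ≠ p_{r+1} q_r`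
(`k₀, l₀ > 0`, `E, Q > 1`), then for all integers `p, q` with `|q| ≥ 1/(2 l₀)`,
`|θ − p/q| > 1/(c |q|^{κ+1})` with `κ = log Q / log E` and `c = 2 k₀ Q (2 E l₀)^κ`.

Everything here is PROVED (`one_div_lt_abs_sub_div_of_approx`), following the printed proof: with
`n₀ = ⌊log(2 l₀ |q|)/log E⌋ + 1` one has `l₀ E^{−n} < 1/(2|q|)` for `n ≥ n₀` and
`Q^{n₀} ≤ (2 E l₀ |q|)^κ`; for such `n`, `q_n ≠ 0`, and if `p/q ≠ p_n/q_n` then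
`|θ − p/q| ≥ |p_n/q_n − p/q| − |θ − p_n/q_n| > 1/(2|q q_n|) > 1/(2 k₀ |q| Qⁿ)`; one of `n₀`, `n₀ + 1`
qualifies because `p_{n₀} q_{n₀+1} ≠ p_{n₀+1} q_{n₀}` (the referee's remark recorded after the lemma:
this is why `c` carries the extra factor `Q`).

## References

* Chen Jian Hua, P. M. Voutier, *Complete solution of the Diophantine equation `X² + 1 = dY⁴` and a
  related family of quartic Thue equations*, J. Number Theory 62 (1997) 71–99, §2, Lemma 8 of the
  arXiv version 1401.5450 (and the Note following it). [ChenVoutier1997]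
-/

noncomputable section

namespace Literature.NumberTheory.DiophantineApproximation

open Real

/-- Along a sequence of approximations with `|q_n θ − p_n| < 1/(2|b|)`, `|q_n| > 0`, any fraction
`a/b ≠ p_n/q_n` satisfies `|θ − a/b| > 1/(2 |b| |q_n|)` (triangle inequality and
`|p_n b − a q_n| ≥ 1`). [cite: ChenVoutier1997, §2 Lemma 8 (arXiv numbering), proof] -/
theorem one_div_lt_abs_sub_div_of_ne {θ : ℝ} {pn qn a b : ℤ} (hqn : qn ≠ 0) (hb : b ≠ 0)
    (hne : pn * b ≠ a * qn) (hsmall : |(qn : ℝ) * θ - pn| < 1 / (2 * |(b : ℝ)|)) :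
    1 / (2 * |(b : ℝ)| * |(qn : ℝ)|) < |θ - a / b| := by
  have hB : 0 < |(b : ℝ)| := by positivity
  have hQ : 0 < |(qn : ℝ)| := by positivity
  have hqnR : (qn : ℝ) ≠ 0 := by exact_mod_cast hqn
  have hbR : (b : ℝ) ≠ 0 := by exact_mod_cast hb
  -- `|p_n b − a q_n| ≥ 1`
  have h1 : (1 : ℝ) ≤ |(pn : ℝ) * b - a * qn| := by
    have : (1 : ℤ) ≤ |pn * b - a * qn| := Int.one_le_abs (sub_ne_zero.2 hne)
    exact_mod_cast this
  -- `|p_n/q_n − a/b| ≥ 1/(|q_n| |b|)`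
  have hY : 1 / (|(qn : ℝ)| * |(b : ℝ)|) ≤ |(pn : ℝ) / qn - a / b| := by
    rw [div_sub_div _ _ hqnR hbR, abs_div, abs_mul]
    exact (div_le_div_iff_of_pos_right (by positivity)).2 (by simpa [mul_comm] using h1)
  -- `|θ − p_n/q_n| < 1/(2|b| |q_n|)`
  have hZ : |θ - pn / qn| < 1 / (2 * |(b : ℝ)| * |(qn : ℝ)|) := by
    have e : θ - pn / qn = ((qn : ℝ) * θ - pn) / qn := by field_simp
    rw [e, abs_div, show 1 / (2 * |(b : ℝ)| * |(qn : ℝ)|) = (1 / (2 * |(b : ℝ)|)) / |(qn : ℝ)| by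
      field_simp]
    exact (div_lt_div_iff_of_pos_right hQ).2 hsmall
  -- triangle inequality
  have hT : |(pn : ℝ) / qn - a / b| ≤ |θ - a / b| + |θ - pn / qn| := by
    have e : (pn : ℝ) / qn - a / b = (θ - a / b) - (θ - pn / qn) := by ring
    rw [e]; exact abs_sub _ _
  have e2 : 1 / (|(qn : ℝ)| * |(b : ℝ)|) - 1 / (2 * |(b : ℝ)| * |(qn : ℝ)|) =
      1 / (2 * |(b : ℝ)| * |(qn : ℝ)|) := by
    field_simp; ring
  linarith

/-- **The approximation lemma of the Thue–Siegel method** [Chen–Voutier, §2, Lemma 8 of the arXiv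
version (with the referee's `Q`)].  Let `θ ∈ ℝ`, `k₀, l₀ > 0`, `E, Q > 1`, and integers `p_r, q_r`
(`r ∈ ℕ`) with `|q_r| < k₀ Qʳ`, `|q_r θ − p_r| ≤ l₀ / Eʳ` and `p_r q_{r+1} ≠ p_{r+1} q_r`.  Then for all
integers `a, b` with `|b| ≥ 1/(2 l₀)`:
`|θ − a/b| > 1 / (c |b|^{κ+1})`, `κ = log Q / log E`, `c = 2 k₀ Q (2 E l₀)^κ`.
[cite: ChenVoutier1997, §2 Lemma 8 (arXiv numbering)] -/
theorem one_div_lt_abs_sub_div_of_approx {θ k₀ l₀ E Q : ℝ} (hk₀ : 0 < k₀) (hl₀ : 0 < l₀)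
    (hE : 1 < E) (hQ : 1 < Q) {p q : ℕ → ℤ} (hq : ∀ r, |(q r : ℝ)| < k₀ * Q ^ r)
    (happrox : ∀ r, |(q r : ℝ) * θ - p r| ≤ l₀ / E ^ r)
    (hne : ∀ r, p r * q (r + 1) ≠ p (r + 1) * q r) (a b : ℤ) (hb : 1 / (2 * l₀) ≤ |(b : ℝ)|) :
    1 / (2 * k₀ * Q * (2 * E * l₀) ^ (Real.log Q / Real.log E) *
        |(b : ℝ)| ^ (Real.log Q / Real.log E + 1)) < |θ - a / b| := by
  set κ : ℝ := Real.log Q / Real.log E with hκ_def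
  set B : ℝ := |(b : ℝ)| with hB_def
  have hE0 : 0 < E := by linarith
  have hQ0 : 0 < Q := by linarith
  have hlogE : 0 < Real.log E := Real.log_pos hE
  have hlogQ : 0 < Real.log Q := Real.log_pos hQ
  have hκ : 0 < κ := div_pos hlogQ hlogE
  have hB : 0 < B := lt_of_lt_of_le (by positivity) hb
  have hb0 : b ≠ 0 := by
    rintro rfl
    simp [hB_def] at hB
  have hB1 : 1 ≤ B := by
    have : (1 : ℤ) ≤ |b| := Int.one_le_abs hb0
    have : ((1 : ℤ) : ℝ) ≤ ((|b| : ℤ) : ℝ) := by exact_mod_cast this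
    simpa [hB_def, Int.cast_abs] using this
  -- `Q = E^κ`
  have hQE : E ^ κ = Q := by
    rw [Real.rpow_def_of_pos hE0, hκ_def]
    have e : Real.log E * (Real.log Q / Real.log E) = Real.log Q := by field_simp
    rw [e, Real.exp_log hQ0]
  -- `2 l₀ B ≥ 1`, `L = log (2 l₀ B) ≥ 0`
  have h2lB : 1 ≤ 2 * l₀ * B := by
    have := (div_le_iff₀ (by positivity : (0 : ℝ) < 2 * l₀)).1 hb
    linarith [this]
  set L : ℝ := Real.log (2 * l₀ * B) with hL_def
  have hL : 0 ≤ L := Real.log_nonneg h2lB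
  -- `n₀ = ⌊L / log E⌋₊ + 1`
  set m : ℕ := ⌊L / Real.log E⌋₊ with hm_def
  have hm_le : (m : ℝ) ≤ L / Real.log E := Nat.floor_le (div_nonneg hL hlogE.le)
  have hm_lt : L / Real.log E < (m : ℝ) + 1 := Nat.lt_floor_add_one _
  -- (i) `E^(m+1) > 2 l₀ B`, i.e. `l₀ / E^(m+1) < 1/(2B)`, also for `m + 2`
  have hEpow : ∀ n : ℕ, m + 1 ≤ n → 2 * l₀ * B < E ^ n := by
    intro n hn
    have h1 : L < n * Real.log E := by
      have : L / Real.log E < n := lt_of_lt_of_le hm_lt (by exact_mod_cast hn)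
      rwa [div_lt_iff₀ hlogE] at this
    calc 2 * l₀ * B = Real.exp L := by rw [hL_def, Real.exp_log (by positivity)]
      _ < Real.exp (n * Real.log E) := Real.exp_lt_exp.2 h1
      _ = E ^ n := by rw [Real.exp_nat_mul, Real.exp_log hE0]
  have hsmall : ∀ n : ℕ, m + 1 ≤ n → l₀ / E ^ n < 1 / (2 * B) := by
    intro n hn
    have hEn : 0 < E ^ n := pow_pos hE0 n
    rw [div_lt_div_iff₀ hEn (by positivity)]
    nlinarith [hEpow n hn]
  -- (ii) `E^(m+1) ≤ 2 E l₀ B`, hence `Q^(m+1) ≤ (2 E l₀ B)^κ`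
  have hEm : E ^ m ≤ 2 * l₀ * B := by
    have h1 : (m : ℝ) * Real.log E ≤ L := by rwa [le_div_iff₀ hlogE] at hm_le
    calc E ^ m = Real.exp (m * Real.log E) := by rw [Real.exp_nat_mul, Real.exp_log hE0]
      _ ≤ Real.exp L := Real.exp_le_exp.2 h1
      _ = 2 * l₀ * B := by rw [hL_def, Real.exp_log (by positivity)]
  have hQm : Q ^ (m + 1) ≤ (2 * E * l₀ * B) ^ κ := by
    have h1 : E ^ (m + 1) ≤ 2 * E * l₀ * B := by
      rw [pow_succ]; nlinarith [hEm, hE0]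
    calc Q ^ (m + 1) = (E ^ κ) ^ (m + 1) := by rw [hQE]
      _ = (E ^ (m + 1)) ^ κ := by
          rw [← Real.rpow_natCast, ← Real.rpow_mul hE0.le, mul_comm, Real.rpow_mul hE0.le,
            Real.rpow_natCast]
      _ ≤ (2 * E * l₀ * B) ^ κ := Real.rpow_le_rpow (by positivity) h1 hκ.le
  -- `q_n ≠ 0` for `n ≥ m + 1`
  have hqne : ∀ n : ℕ, m + 1 ≤ n → q n ≠ 0 := by
    intro n hn h0
    have hp : p n = 0 := by
      have h1 : |(p n : ℝ)| < 1 := by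
        have := happrox n
        rw [h0] at this
        simp only [Int.cast_zero, zero_mul, zero_sub, abs_neg] at this
        have h2 := hsmall n hn
        have h3 : 1 / (2 * B) ≤ 1 := by
          rw [div_le_one (by positivity)]; linarith
        linarith
      have h2 : |p n| < 1 := by exact_mod_cast h1
      have h3 := abs_lt.1 h2
      omega
    exact hne n (by simp [hp, h0])
  -- the bound at a qualifying index `n ∈ {m+1, m+2}`
  have key : ∀ n : ℕ, m + 1 ≤ n → p n * b ≠ a * q n →
      1 / (2 * k₀ * B * Q ^ n) < |θ - a / b| := by
    intro n hn hne'
    have h1 := one_div_lt_abs_sub_div_of_ne (hqne n hn) hb0 hne'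
      (lt_of_le_of_lt (happrox n) (hsmall n hn))
    have h2 : 1 / (2 * k₀ * B * Q ^ n) < 1 / (2 * B * |(q n : ℝ)|) := by
      apply one_div_lt_one_div_of_lt (by have := hqne n hn; positivity)
      have := hq n
      nlinarith [hB]
    exact lt_trans h2 h1
  -- `c B^(κ+1) ≥ 2 k₀ B Q^(m+2)`
  have hpow : B ^ (κ + 1) = B ^ κ * B := by
    rw [Real.rpow_add hB, Real.rpow_one]
  have hsplit : (2 * E * l₀ * B) ^ κ = (2 * E * l₀) ^ κ * B ^ κ :=
    Real.mul_rpow (by positivity) hB.le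
  have hc : 2 * k₀ * B * Q ^ (m + 2) ≤ 2 * k₀ * Q * (2 * E * l₀) ^ κ * B ^ (κ + 1) := by
    rw [hpow, pow_succ]
    have := mul_le_mul_of_nonneg_left hQm (by positivity : (0 : ℝ) ≤ 2 * k₀ * B * Q)
    calc 2 * k₀ * B * (Q ^ (m + 1) * Q) = 2 * k₀ * B * Q * Q ^ (m + 1) := by ring
      _ ≤ 2 * k₀ * B * Q * (2 * E * l₀ * B) ^ κ := this
      _ = 2 * k₀ * Q * (2 * E * l₀) ^ κ * (B ^ κ * B) := by rw [hsplit]; ring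
  have hc' : 2 * k₀ * B * Q ^ (m + 1) ≤ 2 * k₀ * Q * (2 * E * l₀) ^ κ * B ^ (κ + 1) := by
    refine le_trans ?_ hc
    have : Q ^ (m + 1) ≤ Q ^ (m + 2) := pow_le_pow_right₀ hQ.le (by omega)
    exact mul_le_mul_of_nonneg_left this (by positivity)
  have hpos1 : 0 < 2 * k₀ * B * Q ^ (m + 1) := by positivity
  have hpos2 : 0 < 2 * k₀ * B * Q ^ (m + 2) := by positivity
  by_cases hcase : p (m + 1) * b ≠ a * q (m + 1)
  · exact lt_of_le_of_lt (one_div_le_one_div_of_le hpos1 hc') (key (m + 1) le_rfl hcase)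
  · push Not at hcase
    have hcase2 : p (m + 2) * b ≠ a * q (m + 2) := by
      intro h2
      apply hne (m + 1)
      have hq1 := hqne (m + 1) le_rfl
      -- `p_{m+1} b q_{m+2} = a q_{m+1} q_{m+2} = p_{m+2} b q_{m+1}`, cancel `b`
      have : (p (m + 1) * q (m + 2) - p (m + 2) * q (m + 1)) * b = 0 := by
        linear_combination q (m + 2) * hcase - q (m + 1) * h2
      rcases mul_eq_zero.1 this with h | h
      · linear_combination h
      · exact absurd h hb0
    exact lt_of_le_of_lt (one_div_le_one_div_of_le hpos2 hc) (key (m + 2) (by omega) hcase2)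


/-! ## Non-proportionality of consecutive approximants [ChenVoutier1997, §2 Lemma 7 (arXiv numbering)]

The hypothesis `p_r q_{r+1} ≠ p_{r+1} q_r` of `one_div_lt_abs_sub_div_of_approx` is supplied, in the
Thue–Siegel method, by the three-term recurrence the approximants satisfy (Thue's recurrences (2.2) for
`A_r, B_r`, inherited by `K_r = aA_r + bB_r`, `L_r = cA_r + dB_r`): two solutions `K, L` of the same
recurrence `λ_r u_{r+1} = α_r u_r − β_r u_{r−1}` (`r ≥ 1`, `β_r ≠ 0`) have
`λ_r (K_{r+1}L_r − K_rL_{r+1}) = β_r (K_rL_{r−1} − K_{r−1}L_r)`, so the Casoratian never vanishes once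
`K_1L_0 ≠ K_0L_1` — the induction printed as the proof of Lemma 7.
-/

section Casoratian

variable {R : Type*} [CommRing R] {K L lam α β : ℕ → R}

/-- One step of [ChenVoutier1997, §2 Lemma 7]: for two solutions of
`λ_r u_{r+1} = α_r u_r − β_r u_{r−1}`,
`λ_r (K_{r+1} L_r − K_r L_{r+1}) = β_r (K_r L_{r−1} − K_{r−1} L_r)`.
[cite: ChenVoutier1997, §2 Lemma 7 (arXiv numbering), proof] -/
theorem casoratian_step {r : ℕ}
    (hK : lam r * K (r + 1) = α r * K r - β r * K (r - 1))
    (hL : lam r * L (r + 1) = α r * L r - β r * L (r - 1)) :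
    lam r * (K (r + 1) * L r - K r * L (r + 1)) = β r * (K r * L (r - 1) - K (r - 1) * L r) := by
  linear_combination L r * hK - K r * hL

/-- **[ChenVoutier1997, §2 Lemma 7] (abstract form).**  If `K` and `L` satisfy the same recurrence
`λ_r u_{r+1} = α_r u_r − β_r u_{r−1}` for `r ≥ 1` with `β_r ≠ 0` (no hypothesis on `λ_r` is needed
for this direction) in a ring without zero divisors, and `K_1 L_0 ≠ K_0 L_1`, then
`K_{r+1} L_r ≠ K_r L_{r+1}` for all `r ≥ 0` (in the source: `K_r = aA_r + bB_r`, `L_r = cA_r + dB_r`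
with `ad − bc ≠ 0`, the base case being `4h(n+1)P(x)U(x)(ad − bc)/9 ≠ 0`).
[cite: ChenVoutier1997, §2 Lemma 7 (arXiv numbering)] -/
theorem casoratian_ne_zero [NoZeroDivisors R]
    (hK : ∀ r, 1 ≤ r → lam r * K (r + 1) = α r * K r - β r * K (r - 1))
    (hL : ∀ r, 1 ≤ r → lam r * L (r + 1) = α r * L r - β r * L (r - 1))
    (hβ : ∀ r, 1 ≤ r → β r ≠ 0)
    (h0 : K 1 * L 0 ≠ K 0 * L 1) : ∀ r, K (r + 1) * L r ≠ K r * L (r + 1) := by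
  intro r
  induction r with
  | zero => simpa using h0
  | succ r ih =>
    intro h
    have hstep := casoratian_step (hK (r + 1) (by omega)) (hL (r + 1) (by omega))
    simp only [Nat.add_sub_cancel] at hstep
    rw [sub_eq_zero.2 h, mul_zero] at hstep
    rcases mul_eq_zero.1 hstep.symm with h1 | h1
    · exact hβ (r + 1) (by omega) h1
    · exact ih (sub_eq_zero.1 h1)

/-- The Casoratian in closed form along the recurrence:
`(∏_{s=1}^{r} λ_s) (K_{r+1} L_r − K_r L_{r+1}) = (∏_{s=1}^{r} β_s) (K_1 L_0 − K_0 L_1)`.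
[cite: ChenVoutier1997, §2 Lemma 7 (arXiv numbering), proof] -/
theorem prod_mul_casoratian
    (hK : ∀ r, 1 ≤ r → lam r * K (r + 1) = α r * K r - β r * K (r - 1))
    (hL : ∀ r, 1 ≤ r → lam r * L (r + 1) = α r * L r - β r * L (r - 1)) (r : ℕ) :
    (∏ s ∈ Finset.range r, lam (s + 1)) * (K (r + 1) * L r - K r * L (r + 1)) =
      (∏ s ∈ Finset.range r, β (s + 1)) * (K 1 * L 0 - K 0 * L 1) := by
  induction r with
  | zero => simp
  | succ r ih =>
    have hstep := casoratian_step (hK (r + 1) (by omega)) (hL (r + 1) (by omega))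
    simp only [Nat.add_sub_cancel] at hstep
    rw [Finset.prod_range_succ, Finset.prod_range_succ]
    calc (∏ s ∈ Finset.range r, lam (s + 1)) * lam (r + 1) * (K (r + 1 + 1) * L (r + 1) -
          K (r + 1) * L (r + 1 + 1))
        = (∏ s ∈ Finset.range r, lam (s + 1)) * (lam (r + 1) * (K (r + 1 + 1) * L (r + 1) -
          K (r + 1) * L (r + 1 + 1))) := by ring
      _ = (∏ s ∈ Finset.range r, lam (s + 1)) * (β (r + 1) * (K (r + 1) * L r - K r * L (r + 1))) := by
          rw [hstep]
      _ = β (r + 1) * ((∏ s ∈ Finset.range r, lam (s + 1)) * (K (r + 1) * L r - K r * L (r + 1))) := by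
          ring
      _ = (∏ s ∈ Finset.range r, β (s + 1)) * β (r + 1) * (K 1 * L 0 - K 0 * L 1) := by
          rw [ih]; ring

end Casoratian

end Literature.NumberTheory.DiophantineApproximation
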